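import Mathlib
import HarnessLib
import Literature.Analysis.FluidPDE.SuitableWeak
import Literature.Analysis.FluidPDE.SelfSimilar
import Literature.Analysis.FluidPDE.LocalTypeI
import Literature.Analysis.FluidPDE.SpaceTimeRescaling
import Literature.Analysis.FluidPDE.LocalTypeIScaling
import Literature.Analysis.FluidPDE.LocalTypeICongr
import Literature.Analysis.FluidPDE.LocalTypeIReverseZoom
import Literature.Analysis.FluidPDE.SlabTypeICompactness
import Literature.Analysis.FluidPDE.TypeIRateOseenMildRepresentative
import Summits.NavierStokesRegularity.NavierStokesRegularity.Theorems.RellichScarApexLocalisationSpherePersistence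

/-!
# Clean-trunk compactness (line activity-genealogy-fission, crux ApexLocalisation,
# stub `stub_cleanTrunkCompactness`)

The class of the line: suitable weak solutions `(u, p)` of Navier–Stokes on the backward slab
`𝕊 = (-∞, 0) × ℝ³` with weak spatial gradient `G`, Albritton–Barker quantity `𝐈(u,p,G) ≤ I`,
the Type-I rate `‖u(t,x)‖ ≤ C/√(−t)` (`HasTypeITimeDecay C u`), continuous on the open slab.
A profile is `η`-QUIET OUTSIDE THE PARABOLOID of aperture `R` ON THE `ε`-WINDOW when its Type-I
activity `√(−t) ‖u(t,x)‖` is `≤ η` at every point with `t < 0`, `R √(−t) ≤ ‖x‖` and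
`ε ≤ ‖x‖ + √(−t) ≤ ε⁻¹`.

`stub_cleanTrunkCompactness` (S2): if for every `ε > 0` some ORIGIN-SINGULAR continuous class
profile `(C, I)` is `η`-quiet outside the paraboloid of aperture `R` on the `ε`-window, then some
origin-singular continuous class profile `(C, 4I)` is `η`-quiet outside the paraboloid
EVERYWHERE (`t < 0`, `R √(−t) ≤ ‖x‖`).

Proof (Albritton–Barker 2019, Lemma 2.2 + Prop. 2.3 on the slab = the tree's ENGINE
`slab_typeI_compactness`, plus a.e. → pointwise by continuity):

1. choose the profiles `u_k` for `ε_k = 1/(k+1)`;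
2. the ENGINE extracts `σ` and a limit `(v₀, q, H)` with `𝐈 ≤ 4 I` and `u_{σ j} → v₀` in
   `L³(Q(0, R'))` for every `R' > 0`;
3. persistence at the FIXED origin: every `u_{σ j}` is singular at the origin, so
   `‖u_{σ j}‖_{L^∞(Q(0,R'))} = ∞` for all `j`, and the ENGINE makes the origin a backward singular
   point of `v₀`;
4. the rate passes to `v₀` a.e. (`ae_rate_of_tendsto_eLpNorm`), `exists_repr_hasTypeITimeDecay`
   gives a representative with the POINTWISE rate and `exists_oseenMild_repr_of_typeIBound_lt_top`
   a CONTINUOUS one `v` keeping the rate; the class data, the singular origin and the `L³_loc`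
   convergence are transferred along the a.e. equalities (`classData_congr_ae`);
5. at a point `(t, x)` of the OPEN set `{t < 0, R √(−t) < ‖x‖}` the windows eventually contain
   `‖x‖ + √(−t)`, so `√(−t) ‖u_{σ j}(t,x)‖ ≤ η` for `j` large; this passes to `v` a.e.
   (a.e.-convergent subsequences ball by ball, `ae_quiet_of_eventually_quiet_of_tendsto_eLpNorm`),
   then everywhere on the open set by continuity (the failure set is open and null), and finally
   to the boundary `‖x‖ = R √(−t) > 0` by continuity of `y ↦ v(t, y)` (the quiet set at time `t`
   is closed and contains the exterior of the closed ball of radius `R √(−t)`, hence the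
   exterior of the open ball; `quiet_of_ae_quiet_of_continuousOn`).

## References

* D. Albritton, T. Barker, *On local Type I singularities of the Navier–Stokes equations and
  Liouville theorems*, J. Math. Fluid Mech. 21 (2019) = arXiv:1811.00502, Lemma 2.2, Prop. 2.3,
  §3. [AlbrittonBarker2019]
-/

set_option linter.dupNamespace false

namespace Summit.NavierStokesRegularity.NavierStokesRegularity.Theorems.RellichScarApexLocalisation

open MeasureTheory Set Function Metric Filter Topology TopologicalSpace
open scoped ENNReal NNReal
open Literature.Analysis Literature.Analysis.FluidPDE

/-! ### Tool 1: eventual quietness of the approximants passes a.e. to `L³_loc` limits -/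

-- adapted from `ae_slab_le_of_eventually_le_of_tendsto_eLpNorm`
-- (Theorems/RellichScarApexLocalisationConfinementImpliesApex.lean), specialised to the paraboloid
/-- **Eventual quietness passes a.e. to `L³_loc` limits.** If measurable fields `W j` converge to
a measurable `v` in `L³(Q(0, n+1))` for every `n`, and at each point `(t, x)` of the open slab
with `R √(−t) < ‖x‖` the bound `√(−t) ‖W j (t, x)‖ ≤ η` holds for all large `j`, then
`√(−t) ‖v(t, x)‖ ≤ η` for a.e. `(t, x)` in the slab with `R √(−t) < ‖x‖` (a.e.-convergent
subsequences ball by ball; the balls `Q(0, n+1)` exhaust the slab). -/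
theorem ae_quiet_of_eventually_quiet_of_tendsto_eLpNorm
    {W : ℕ → ℝ → (EuclideanSpace ℝ (Fin 3)) → (EuclideanSpace ℝ (Fin 3))}
    {v : ℝ → (EuclideanSpace ℝ (Fin 3)) → (EuclideanSpace ℝ (Fin 3))} {R η : ℝ}
    (hWm : ∀ j, AEStronglyMeasurable (uncurry (W j))
      (volume.restrict (Iio (0 : ℝ) ×ˢ (univ : Set (EuclideanSpace ℝ (Fin 3))))))
    (hvm : AEStronglyMeasurable (uncurry v)
      (volume.restrict (Iio (0 : ℝ) ×ˢ (univ : Set (EuclideanSpace ℝ (Fin 3))))))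
    (hWB : ∀ z : ℝ × (EuclideanSpace ℝ (Fin 3)), z.1 < 0 → R * Real.sqrt (-z.1) < ‖z.2‖ →
      ∀ᶠ j in atTop, Real.sqrt (-z.1) * ‖W j z.1 z.2‖ ≤ η)
    (hL3 : ∀ n : ℕ, Tendsto (fun j => eLpNorm (uncurry (W j) - uncurry v) 3
      (volume.restrict (parabolicCylinder ((n : ℝ) + 1) (0 : ℝ × (EuclideanSpace ℝ (Fin 3))))))
      atTop (𝓝 0)) :
    ∀ᵐ z ∂(volume.restrict (Iio (0 : ℝ) ×ˢ (univ : Set (EuclideanSpace ℝ (Fin 3))))),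
      R * Real.sqrt (-z.1) < ‖z.2‖ → Real.sqrt (-z.1) * ‖v z.1 z.2‖ ≤ η := by
  refine ae_restrict_of_ae_restrict_of_subset lowerHalf_subset_iUnion_parabolicCylinder ?_
  rw [ae_restrict_iUnion_iff]
  intro n
  set Q₀ : Set (ℝ × (EuclideanSpace ℝ (Fin 3))) :=
    parabolicCylinder ((n : ℝ) + 1) (0 : ℝ × (EuclideanSpace ℝ (Fin 3)))
  have hQ₀s : Q₀ ⊆ Iio (0 : ℝ) ×ˢ (univ : Set (EuclideanSpace ℝ (Fin 3))) :=
    parabolicCylinder_origin_subset_slab _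
  have hWm' : ∀ j, AEStronglyMeasurable (uncurry (W j)) (volume.restrict Q₀) := fun j =>
    (hWm j).mono_measure (Measure.restrict_mono hQ₀s le_rfl)
  have hvm' : AEStronglyMeasurable (uncurry v) (volume.restrict Q₀) :=
    hvm.mono_measure (Measure.restrict_mono hQ₀s le_rfl)
  have hTIM : TendstoInMeasure (volume.restrict Q₀) (fun j => uncurry (W j)) atTop (uncurry v) :=
    tendstoInMeasure_of_tendsto_eLpNorm (by norm_num) hWm' hvm' (hL3 n)
  obtain ⟨ns, hns, hae⟩ := hTIM.exists_seq_tendsto_ae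
  filter_upwards [hae, ae_restrict_mem (isOpen_parabolicCylinder _ _).measurableSet] with z hz hzQ
  intro hP
  have hev : ∀ᶠ i in atTop, Real.sqrt (-z.1) * ‖W (ns i) z.1 z.2‖ ≤ η :=
    hns.tendsto_atTop.eventually (hWB z (hQ₀s hzQ).1 hP)
  exact le_of_tendsto (hz.norm.const_mul (Real.sqrt (-z.1))) hev

/-! ### Tool 2: a.e. quietness off the open paraboloid is quietness off the closed one -/

-- the open-set step is adapted from `sqrt_mul_norm_le_of_ae_of_continuousOn`
-- (Theorems/RellichScarApexLocalisationConfinementImpliesApex.lean, case `e₀ = 0`)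
/-- **A.e. quietness is quietness, for continuous fields, up to the boundary of the paraboloid.**
If `v` is continuous on the open slab, `R > 0`, and `√(−t) ‖v(t,x)‖ ≤ η` for a.e. `(t,x)` in the
slab with `R √(−t) < ‖x‖`, then the bound holds at EVERY point with `t < 0`, `R √(−t) ≤ ‖x‖`:
the failure set inside the open set `{R √(−t) < ‖x‖}` is open and null, hence empty; and at fixed
`t < 0` the quiet set is closed and contains the exterior of the closed ball of radius
`R √(−t) > 0`, whose closure is the exterior of the open ball. -/
theorem quiet_of_ae_quiet_of_continuousOn
    {v : ℝ → (EuclideanSpace ℝ (Fin 3)) → (EuclideanSpace ℝ (Fin 3))} {R η : ℝ} (hR : 0 < R)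
    (hvcont : ContinuousOn (uncurry v) (Iio (0 : ℝ) ×ˢ univ))
    (hae : ∀ᵐ z ∂(volume.restrict (Iio (0 : ℝ) ×ˢ (univ : Set (EuclideanSpace ℝ (Fin 3))))),
      R * Real.sqrt (-z.1) < ‖z.2‖ → Real.sqrt (-z.1) * ‖v z.1 z.2‖ ≤ η) :
    ∀ t : ℝ, t < 0 → ∀ x : EuclideanSpace ℝ (Fin 3), R * Real.sqrt (-t) ≤ ‖x‖ →
      Real.sqrt (-t) * ‖v t x‖ ≤ η := by
  -- ## the open set `O = {t < 0, R √(-t) < ‖x‖}`: the failure set is open and null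
  have hU : ∀ s : ℝ, s < 0 → ∀ y : EuclideanSpace ℝ (Fin 3), R * Real.sqrt (-s) < ‖y‖ →
      Real.sqrt (-s) * ‖v s y‖ ≤ η := by
    intro s hs y hy
    by_contra hlt
    push Not at hlt
    set O : Set (ℝ × (EuclideanSpace ℝ (Fin 3))) := {z | z.1 < 0 ∧ R * Real.sqrt (-z.1) < ‖z.2‖}
    have hOopen : IsOpen O :=
      (isOpen_lt continuous_fst continuous_const).and
        (isOpen_lt (continuous_const.mul continuous_fst.neg.sqrt) continuous_snd.norm)
    have hOs : O ⊆ Iio (0 : ℝ) ×ˢ univ := fun z hz => ⟨hz.1, mem_univ _⟩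
    have hg : ContinuousOn
        (fun z : ℝ × (EuclideanSpace ℝ (Fin 3)) => Real.sqrt (-z.1) * ‖uncurry v z‖) O :=
      continuous_fst.neg.sqrt.continuousOn.mul (hvcont.mono hOs).norm
    have hVopen : IsOpen (O ∩ (fun z : ℝ × (EuclideanSpace ℝ (Fin 3)) =>
        Real.sqrt (-z.1) * ‖uncurry v z‖) ⁻¹' Ioi η) :=
      hg.isOpen_inter_preimage hOopen isOpen_Ioi
    have hmem : ((s, y) : ℝ × (EuclideanSpace ℝ (Fin 3))) ∈
        O ∩ (fun z : ℝ × (EuclideanSpace ℝ (Fin 3)) =>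
          Real.sqrt (-z.1) * ‖uncurry v z‖) ⁻¹' Ioi η :=
      ⟨⟨hs, hy⟩, hlt⟩
    have hpos := hVopen.measure_pos volume ⟨_, hmem⟩
    have hnull : volume.restrict (Iio (0 : ℝ) ×ˢ (univ : Set (EuclideanSpace ℝ (Fin 3))))
        (O ∩ (fun z : ℝ × (EuclideanSpace ℝ (Fin 3)) =>
          Real.sqrt (-z.1) * ‖uncurry v z‖) ⁻¹' Ioi η) = 0 := by
      refine measure_mono_null (fun z hz => ?_) (ae_iff.1 hae)
      have h2 : η < Real.sqrt (-z.1) * ‖uncurry v z‖ := hz.2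
      exact fun h => (not_le.2 h2) (h hz.1.2)
    rw [Measure.restrict_apply hVopen.measurableSet,
      inter_eq_left.2 (inter_subset_left.trans hOs)] at hnull
    exact hpos.ne' hnull
  -- ## the boundary, at fixed `t < 0`
  intro t ht x hx
  have hr : 0 < R * Real.sqrt (-t) := mul_pos hR (Real.sqrt_pos.2 (neg_pos.2 ht))
  -- `y ↦ √(-t) ‖v(t, y)‖` is continuous on `ℝ³`
  have hct : Continuous (uncurry v ∘ fun y : EuclideanSpace ℝ (Fin 3) => (t, y)) :=
    hvcont.comp_continuous (Continuous.prodMk_right t) fun _ => ⟨ht, mem_univ _⟩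
  have hcf : Continuous fun y : EuclideanSpace ℝ (Fin 3) => Real.sqrt (-t) * ‖v t y‖ :=
    continuous_const.mul hct.norm
  have hclosed : IsClosed {y : EuclideanSpace ℝ (Fin 3) | Real.sqrt (-t) * ‖v t y‖ ≤ η} :=
    isClosed_le hcf continuous_const
  -- the quiet set contains the exterior of the closed ball, hence its closure
  have hsub : (closedBall (0 : EuclideanSpace ℝ (Fin 3)) (R * Real.sqrt (-t)))ᶜ ⊆
      {y : EuclideanSpace ℝ (Fin 3) | Real.sqrt (-t) * ‖v t y‖ ≤ η} := fun y hy => by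
    rw [mem_compl_iff, mem_closedBall, dist_zero_right, not_le] at hy
    exact hU t ht y hy
  have hcl := hclosed.closure_subset_iff.2 hsub
  rw [closure_compl, interior_closedBall _ hr.ne'] at hcl
  refine hcl ?_
  rw [mem_compl_iff, mem_ball, dist_zero_right, not_lt]
  exact hx

/-! ### The stub -/

/-- **S2, CLEAN-TRUNK COMPACTNESS** (Albritton–Barker 2019 Lemma 2.2 + Prop. 2.3 on the slab =
the tree's `slab_typeI_compactness`, persistence at the fixed origin, a.e. → pointwise by
continuity): if for every `ε > 0` some origin-singular continuous class profile `(C, I)`,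
`I < ⊤`, is `η`-quiet outside the paraboloid of aperture `R > 0` on the window
`ε ≤ ‖x‖ + √(−t) ≤ ε⁻¹`, then some origin-singular continuous class profile `(C, 4I)` is
`η`-quiet outside the paraboloid everywhere: `√(−t) ‖u(t,x)‖ ≤ η` whenever `t < 0`,
`R √(−t) ≤ ‖x‖`.
[cite: AlbrittonBarker2019, Lemma 2.2, Prop. 2.3 and §3] -/
theorem stub_cleanTrunkCompactness :
    ∀ (C : ℝ) (I : ℝ≥0∞) (η R : ℝ), I < ⊤ → 0 < R →
      (∀ ε : ℝ, 0 < ε →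
        ∃ (u : ℝ → (EuclideanSpace ℝ (Fin 3)) → (EuclideanSpace ℝ (Fin 3))) (p : ℝ → (EuclideanSpace ℝ (Fin 3)) → ℝ) (G : ℝ → (EuclideanSpace ℝ (Fin 3)) → (EuclideanSpace ℝ (Fin 3)) →L[ℝ] (EuclideanSpace ℝ (Fin 3))),
          IsSuitableWeakSolutionOn (slab (EuclideanSpace ℝ (Fin 3)) (Iio 0) isOpen_Iio) 1 0 u p ∧
          HasWeakSpatialGradientOn (slab (EuclideanSpace ℝ (Fin 3)) (Iio 0) isOpen_Iio) u G ∧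
          typeIBound (Iio (0 : ℝ) ×ˢ univ) u p G ≤ I ∧
          HasTypeITimeDecay C u ∧
          ContinuousOn (uncurry u) (Iio (0 : ℝ) ×ˢ univ) ∧
          IsBackwardSingularPoint u 0 ∧
          ∀ t : ℝ, t < 0 → ∀ x : (EuclideanSpace ℝ (Fin 3)), ε ≤ ‖x‖ + Real.sqrt (-t) → ‖x‖ + Real.sqrt (-t) ≤ ε⁻¹ →
            R * Real.sqrt (-t) ≤ ‖x‖ → Real.sqrt (-t) * ‖u t x‖ ≤ η) →
      ∃ (u : ℝ → (EuclideanSpace ℝ (Fin 3)) → (EuclideanSpace ℝ (Fin 3))) (p : ℝ → (EuclideanSpace ℝ (Fin 3)) → ℝ) (G : ℝ → (EuclideanSpace ℝ (Fin 3)) → (EuclideanSpace ℝ (Fin 3)) →L[ℝ] (EuclideanSpace ℝ (Fin 3))),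
        IsSuitableWeakSolutionOn (slab (EuclideanSpace ℝ (Fin 3)) (Iio 0) isOpen_Iio) 1 0 u p ∧
        HasWeakSpatialGradientOn (slab (EuclideanSpace ℝ (Fin 3)) (Iio 0) isOpen_Iio) u G ∧
        typeIBound (Iio (0 : ℝ) ×ˢ univ) u p G ≤ 4 * I ∧
        HasTypeITimeDecay C u ∧
        ContinuousOn (uncurry u) (Iio (0 : ℝ) ×ˢ univ) ∧
        IsBackwardSingularPoint u 0 ∧
        ∀ t : ℝ, t < 0 → ∀ x : (EuclideanSpace ℝ (Fin 3)), R * Real.sqrt (-t) ≤ ‖x‖ → Real.sqrt (-t) * ‖u t x‖ ≤ η := by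
  intro C I η R hI hR hwin
  -- ## Step 1: the profiles for the windows `ε_k = 1/(k+1)`
  have hε : ∀ k : ℕ, (0 : ℝ) < 1 / ((k : ℝ) + 1) := fun k => by positivity
  choose u p G hsw hwg hIle hC hcont hsing hquiet using fun k : ℕ => hwin (1 / ((k : ℝ) + 1)) (hε k)
  -- `0 ≤ C` (the rate of `u 0` at `(t, x) = (-1, 0)`)
  have hC0 : 0 ≤ C := by
    have h := hC 0 (-1) (by norm_num) 0
    rw [neg_neg, Real.sqrt_one, div_one] at h
    exact (norm_nonneg _).trans h
  -- ## Step 2: the ENGINE, on the sequence itself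
  obtain ⟨v₀, q, H, σ, hσ, hsw₀, hwg₀, hI₀, hconv₀, hpers₀⟩ :=
    slab_typeI_compactness I u p G hI hsw hwg hIle
  -- ## Step 3: persistence at the fixed origin — every approximant is singular there
  have hsing₀ : IsBackwardSingularPoint v₀ 0 := by
    refine hpers₀ fun R' hR' => ?_
    have hconst : (fun j => eLpNorm (uncurry (u (σ j))) ⊤
        (volume.restrict (parabolicCylinder R' (0 : ℝ × (EuclideanSpace ℝ (Fin 3)))))) =
        fun _ => (⊤ : ℝ≥0∞) :=
      funext fun j => hsing (σ j) R' hR'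
    rw [hconst]
    exact limsup_const ⊤
  -- ## Step 4: the rate a.e., a representative with the pointwise rate, a continuous one
  have hrate₀ : ∀ᵐ z ∂(volume.restrict (Iio (0 : ℝ) ×ˢ (univ : Set (EuclideanSpace ℝ (Fin 3))))),
      ‖v₀ z.1 z.2‖ ≤ C / Real.sqrt (-z.1) :=
    ae_rate_of_tendsto_eLpNorm (W := fun j => u (σ j))
      (fun j => (hwg (σ j)).locallyIntegrableOn.aestronglyMeasurable)
      hwg₀.locallyIntegrableOn.aestronglyMeasurable (fun j => hC (σ j))
      (fun n => hconv₀ ((n : ℝ) + 1) (by positivity))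
  obtain ⟨v₁, hae₁, hC₁⟩ := exists_repr_hasTypeITimeDecay hC0 hrate₀
  obtain ⟨hsw₁, hwg₁, hI₁, hsing₁, hconv₁⟩ := classData_congr_ae hae₁ hsw₀ hwg₀ hI₀ hsing₀ hconv₀
  have hI₁top : typeIBound (Iio (0 : ℝ) ×ˢ univ) v₁ q H < ⊤ :=
    lt_of_le_of_lt hI₁ (ENNReal.mul_lt_top (by simp) hI)
  obtain ⟨v, hae₂, hvcont, -, -, hvC⟩ := exists_oseenMild_repr_of_typeIBound_lt_top hsw₁ hC₁ hI₁top
  obtain ⟨hswv, hwgv, hIv, hsingv, hconvv⟩ := classData_congr_ae hae₂ hsw₁ hwg₁ hI₁ hsing₁ hconv₁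
  -- ## Step 5: quietness passes to the limit, a.e. on the open set `{t < 0, R √(-t) < ‖x‖}`
  have hae : ∀ᵐ z ∂(volume.restrict (Iio (0 : ℝ) ×ˢ (univ : Set (EuclideanSpace ℝ (Fin 3))))),
      R * Real.sqrt (-z.1) < ‖z.2‖ → Real.sqrt (-z.1) * ‖v z.1 z.2‖ ≤ η := by
    refine ae_quiet_of_eventually_quiet_of_tendsto_eLpNorm (W := fun j => u (σ j))
      (fun j => (hwg (σ j)).locallyIntegrableOn.aestronglyMeasurable)
      hwgv.locallyIntegrableOn.aestronglyMeasurable (fun z hz0 hz => ?_)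
      (fun n => hconvv ((n : ℝ) + 1) (by positivity))
    -- the windows eventually contain `‖z.2‖ + √(-z.1) > 0`
    have hpos : 0 < ‖z.2‖ + Real.sqrt (-z.1) :=
      add_pos_of_nonneg_of_pos (norm_nonneg _) (Real.sqrt_pos.2 (neg_pos.2 hz0))
    have hεσ : Tendsto (fun j => 1 / (((σ j : ℕ) : ℝ) + 1)) atTop (𝓝 0) :=
      tendsto_one_div_add_atTop_nhds_zero_nat.comp hσ.tendsto_atTop
    have hinv : Tendsto (fun j => ((σ j : ℕ) : ℝ) + 1) atTop atTop :=
      tendsto_atTop_add_const_right _ _ (tendsto_natCast_atTop_atTop.comp hσ.tendsto_atTop)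
    filter_upwards [hεσ.eventually_le_const hpos,
      hinv.eventually_ge_atTop (‖z.2‖ + Real.sqrt (-z.1))] with j hj₁ hj₂
    refine hquiet (σ j) z.1 hz0 z.2 hj₁ ?_ hz.le
    rwa [one_div, inv_inv]
  -- ## Step 6: assemble; a.e. → everywhere off the closed paraboloid by continuity
  exact ⟨v, q, H, hswv, hwgv, hIv, hvC, hvcont, hsingv,
    quiet_of_ae_quiet_of_continuousOn hR hvcont hae⟩

end Summit.NavierStokesRegularity.NavierStokesRegularity.Theorems.RellichScarApexLocalisation
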